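import Summits.Ventures.HodgeRepro2.T5InertHeckeCommutative
import Summits.Ventures.HodgeRepro2.T5AdicCompletionIntegral
import Summits.Ventures.HodgeRepro2.T5AdicCompletionMap
import Summits.Ventures.HodgeRepro2.T5AdicCompletionResidueField

/-!
# The inert-place Hecke package on Mathlib's adic completions (Tier-5 support, N3)

The inert-place package of `T5InertHeckeCommutative` (p8, gen 13) is stated for an abstract
carrier `(R₀, F, E)`: `R₀` a DVR with finite residue field, `F` its fraction field, `E/F` a
quadratic extension with `𝒪_E := integralClosure R₀ E` LOCAL and `𝔭_{R₀} 𝒪_E = 𝔭_{𝒪_E}`.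
This file instantiates it on the CONCRETE local fields of the record: `Kv := v.adicCompletion K`,
`Lw := w.adicCompletion L` for number fields `K ⊆ L` and places `w ∣ v` (Mathlib's
`IsDedekindDomain.HeightOneSpectrum.adicCompletion`, with p4's instances on the pair —
`T5AdicCompletionIntegral`: `IsIntegralClosure O_Lw O_Kv Lw`, `CharZero Kv`;
`T5AdicCompletionResidueField`: the finiteness of the residue field of `O_Kv`).

* `isLocalRing_integralClosure_of_isIntegralClosure`: `integralClosure R B` is local whenever
  some integral closure `A` of `R` in `B` is (transport along `IsIntegralClosure.equiv`) —
  so `𝒪_{E_v} = integralClosure O_Kv Lw` is LOCAL because `O_Lw` is a valuation ring: the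
  instance hypothesis `[IsLocalRing (integralClosure R₀ E)]` of the package is DISCHARGED.
* `map_maximalIdeal_integralClosure_eq_of_irreducible`: the hypothesis `hunr`
  (`𝔭_{R₀} 𝒪_E = 𝔭_{𝒪_E}`) from the inertness of `w ∣ v` in p4's form (a uniformiser of
  `O_Kv` stays irreducible in `O_Lw`, i.e. `e(w/v) = 1`).
* `isGalois_adicCompletion` / `exists_algEquiv_ne_one`: `Lw/Kv` of degree 2 is Galois
  (characteristic 0 — Mathlib's `Algebra.IsQuadraticExtension.isGalois`) and has a non-trivial
  automorphism.
* `hyperspecialSubgroup_integralClosure_eq`: the stabiliser `K_H` of the self-dual lattice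
  does not depend on the spelling of the ring of integers (`integralClosure O_Kv Lw` or `O_Lw`).
* `heckeAlgebra_mul_comm_adicCompletion` / `heckeAlgebra_mul_comm_adicCompletion'`:
  **the spherical Hecke algebra `H(U(H), K_H)` of the record's hermitian space is commutative
  at every inert place of the record's local fields** — `H` hermitian for the Galois
  conjugation of `Lw/Kv` with entries and inverse in `O_Lw`, isotropic — with no residual
  hypothesis beyond `[Lw : Kv] = 2`, `e(w/v) = 1` and the data of `H`.

What stays prose: that the record's `E_v/F_v` IS such a pair `(Lw, Kv)` with `w ∣ v` (the
datum's places), the isotropy of the record's `V_v` (printed), the choice of its self-dual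
lattice. No L-value anywhere (README §8(d): NO).
-/

namespace Summit.Ventures.HodgeRepro2.T5InertPlaceCompletion

open IsDedekindDomain HeightOneSpectrum IsLocalRing

section General

variable {R A B : Type*} [CommRing R] [CommRing A] [CommRing B] [Algebra R B] [Algebra A B]
  [Algebra R A] [IsScalarTower R A B] [IsIntegralClosure A R B]

/-- `integralClosure R B` is local as soon as some integral closure `A` of `R` in `B` is local
(the two are isomorphic as `R`-algebras by `IsIntegralClosure.equiv`, and a surjective image of a
local ring is local). -/
theorem isLocalRing_integralClosure_of_isIntegralClosure [IsLocalRing A] [Nontrivial B] :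
    IsLocalRing (integralClosure R B) :=
  IsLocalRing.of_surjective'
    ((IsIntegralClosure.equiv R A B (integralClosure R B) : A ≃ₐ[R] integralClosure R B) :
      A →+* integralClosure R B)
    (IsIntegralClosure.equiv R A B (integralClosure R B)).surjective

/-- An element of `R` irreducible in the integral closure `A` is irreducible in
`integralClosure R B`. -/
theorem irreducible_algebraMap_integralClosure {ϖ : R} (h : Irreducible (algebraMap R A ϖ)) :
    Irreducible (algebraMap R (integralClosure R B) ϖ) := by
  have h' := (MulEquiv.irreducible_iff (IsIntegralClosure.equiv R A B (integralClosure R B))).mpr h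
  rwa [AlgEquiv.commutes] at h'

omit [Algebra R A] [IsScalarTower R A B] in
/-- The image of `integralClosure R B` in `B` is the image of any integral closure `A`. -/
theorem exists_algebraMap_integralClosure_eq_iff {x : B} :
    (∃ y : integralClosure R B, algebraMap (integralClosure R B) B y = x) ↔
      ∃ y : A, algebraMap A B y = x := by
  constructor
  · rintro ⟨⟨y, hy⟩, rfl⟩
    exact IsIntegralClosure.isIntegral_iff.mp hy
  · rintro ⟨y, rfl⟩
    exact ⟨⟨algebraMap A B y, IsIntegralClosure.isIntegral_iff.mpr ⟨y, rfl⟩⟩, rfl⟩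

omit [Algebra R A] [IsScalarTower R A B] in
/-- `IsInteger` for `integralClosure R B` is `IsInteger` for any integral closure `A`. -/
theorem isInteger_integralClosure_iff_of_isIntegralClosure {x : B} :
    IsLocalization.IsInteger (integralClosure R B) x ↔ IsLocalization.IsInteger A x := by
  simp only [IsLocalization.IsInteger, RingHom.mem_rangeS]
  exact exists_algebraMap_integralClosure_eq_iff

end General

section GeneralField

variable {R A B : Type*} [CommRing R] [CommRing A] [Field B] [Algebra R B] [Algebra A B]
  [IsIntegralClosure A R B]

/-- The integral points of `GL ι B` are the same for `integralClosure R B` and for any integral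
closure `A` (both fraction rings of `B`). -/
theorem range_map_algebraMap_integralClosure_eq [IsFractionRing (integralClosure R B) B]
    [IsFractionRing A B] {ι : Type*} [Fintype ι] [DecidableEq ι] :
    (Matrix.GeneralLinearGroup.map (n := ι) (algebraMap (integralClosure R B) B)).range =
      (Matrix.GeneralLinearGroup.map (n := ι) (algebraMap A B)).range := by
  ext g
  constructor
  · intro hg
    refine T5UnitaryThreeCorner.mem_range_of_integral g (fun i j => ?_) (fun i j => ?_)
    · exact (isInteger_integralClosure_iff_of_isIntegralClosure (A := A)).mp
        (T5UnitaryGroupIsometry.isInteger_apply_of_mem_range hg i j)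
    · exact (isInteger_integralClosure_iff_of_isIntegralClosure (A := A)).mp
        (T5UnitaryGroupIsometry.isInteger_inv_apply_of_mem_range hg i j)
  · intro hg
    refine T5UnitaryThreeCorner.mem_range_of_integral g (fun i j => ?_) (fun i j => ?_)
    · exact (isInteger_integralClosure_iff_of_isIntegralClosure (A := A)).mpr
        (T5UnitaryGroupIsometry.isInteger_apply_of_mem_range hg i j)
    · exact (isInteger_integralClosure_iff_of_isIntegralClosure (A := A)).mpr
        (T5UnitaryGroupIsometry.isInteger_inv_apply_of_mem_range hg i j)

/-- The stabiliser `K_J` of the standard lattice in `U(J)` is the same subgroup whether the ring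
of integers is spelled `integralClosure R B` or `A`. -/
theorem hyperspecialSubgroup_integralClosure_eq [StarRing B]
    [IsFractionRing (integralClosure R B) B] [IsFractionRing A B] {ι : Type*} [Fintype ι]
    [DecidableEq ι] (J : Matrix ι ι B) :
    T5UnitaryHeckeAdjoint.hyperspecialSubgroup (integralClosure R B) J =
      T5UnitaryHeckeAdjoint.hyperspecialSubgroup A J := by
  unfold T5UnitaryHeckeAdjoint.hyperspecialSubgroup
  rw [range_map_algebraMap_integralClosure_eq (A := A)]

end GeneralField

section Completion

variable {K : Type*} [Field K] [NumberField K] (v : HeightOneSpectrum (NumberField.RingOfIntegers K))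
  {L : Type*} [Field L] [NumberField L] [Algebra K L]
  (w : HeightOneSpectrum (NumberField.RingOfIntegers L)) [w.asIdeal.LiesOver v.asIdeal]

/-- `𝒪_{E_v} := integralClosure O_Kv Lw` is LOCAL: `O_Lw` is a valuation ring and an integral
closure of `O_Kv` in `Lw` (p4's `T5AdicCompletionIntegral.isIntegralClosure_adicCompletionIntegers`).
The instance hypothesis of the inert-place package is discharged on the concrete pair. -/
theorem isLocalRing_integralClosure_adicCompletion :
    IsLocalRing (integralClosure (v.adicCompletionIntegers K) (w.adicCompletion L)) :=
  isLocalRing_integralClosure_of_isIntegralClosure (A := w.adicCompletionIntegers L)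

/-- `𝒪_{E_v}` is a discrete valuation ring (`T5UnramifiedUniformiser`, given locality). -/
theorem isDiscreteValuationRing_integralClosure_adicCompletion :
    IsDiscreteValuationRing (integralClosure (v.adicCompletionIntegers K) (w.adicCompletion L)) :=
  haveI := isLocalRing_integralClosure_adicCompletion v w
  T5UnramifiedUniformiser.isDiscreteValuationRing_integralClosure (v.adicCompletionIntegers K)
    (v.adicCompletion K) (w.adicCompletion L)

/-- The hypothesis `hunr` of the package on the concrete pair: if a uniformiser `ϖ` of `O_Kv`
stays irreducible in `O_Lw` (`e(w/v) = 1`, p4's form of «`v` is unramified in `w`»), then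
`𝔭_{O_Kv} 𝒪_{E_v} = 𝔭_{𝒪_{E_v}}`. -/
theorem map_maximalIdeal_integralClosure_eq_of_irreducible {ϖ : v.adicCompletionIntegers K}
    (hϖ : Irreducible ϖ)
    (hinert : Irreducible (algebraMap (v.adicCompletionIntegers K) (w.adicCompletionIntegers L) ϖ)) :
    haveI := isLocalRing_integralClosure_adicCompletion v w
    Ideal.map (algebraMap (v.adicCompletionIntegers K)
        (integralClosure (v.adicCompletionIntegers K) (w.adicCompletion L)))
        (maximalIdeal (v.adicCompletionIntegers K)) =
      maximalIdeal (integralClosure (v.adicCompletionIntegers K) (w.adicCompletion L)) := by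
  haveI := isLocalRing_integralClosure_adicCompletion v w
  haveI := isDiscreteValuationRing_integralClosure_adicCompletion v w
  rw [T5UnramifiedUniformiser.map_maximalIdeal_eq_span hϖ]
  exact (Irreducible.maximalIdeal_eq
    (irreducible_algebraMap_integralClosure (A := w.adicCompletionIntegers L) hinert)).symm

/-- A quadratic extension of local fields of characteristic 0 is Galois
(Mathlib's `Algebra.IsQuadraticExtension.isGalois`; `CharZero Kv` is p4's instance). -/
theorem isGalois_adicCompletion (h2 : Module.finrank (v.adicCompletion K) (w.adicCompletion L) = 2) :
    IsGalois (v.adicCompletion K) (w.adicCompletion L) :=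
  haveI : Algebra.IsQuadraticExtension (v.adicCompletion K) (w.adicCompletion L) := ⟨h2⟩
  inferInstance

/-- The Galois conjugation of `Lw/Kv`: a non-trivial `Kv`-automorphism of `Lw` exists. -/
theorem exists_algEquiv_ne_one (h2 : Module.finrank (v.adicCompletion K) (w.adicCompletion L) = 2) :
    ∃ σ : (w.adicCompletion L) ≃ₐ[v.adicCompletion K] (w.adicCompletion L), σ ≠ 1 :=
  haveI := isGalois_adicCompletion v w h2
  T5StarOfInvolution.exists_ne_one_of_finrank_eq_two h2

/-- **The inert-place package on the record's local fields.** For number fields `K ⊆ L`, places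
`w ∣ v` with `[Lw : Kv] = 2` and `e(w/v) = 1` (a uniformiser of `O_Kv` stays irreducible in
`O_Lw`), `σ` the non-trivial automorphism of `Lw/Kv` (the star), and `H` a hermitian `3 × 3`
matrix over `Lw` with entries and inverse in `𝒪_{E_v} = integralClosure O_Kv Lw` (the Gram matrix
of a self-dual lattice), unit determinant and an isotropic vector: the spherical Hecke algebra
`H(U(H), K_H)` of `U(H)` with respect to the stabiliser of the lattice is commutative
(`T5InertHeckeCommutative.heckeAlgebra_mul_comm_of_isotropic_of_unramified` with every
hypothesis on the carrier discharged). -/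
theorem heckeAlgebra_mul_comm_adicCompletion
    (h2 : Module.finrank (v.adicCompletion K) (w.adicCompletion L) = 2)
    {ϖ : v.adicCompletionIntegers K} (hϖ : Irreducible ϖ)
    (hinert : Irreducible (algebraMap (v.adicCompletionIntegers K) (w.adicCompletionIntegers L) ϖ))
    (σ : (w.adicCompletion L) ≃ₐ[v.adicCompletion K] (w.adicCompletion L)) (hσ : σ ≠ 1)
    (H : Matrix (Fin 3) (Fin 3) (w.adicCompletion L)) (k : Type*) [Field k]
    (hH : letI := T5StarOfInvolution.starRingOfQuadratic h2 σ hσ; H.IsHermitian)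
    (hHint : ∀ i j, IsLocalization.IsInteger
      (integralClosure (v.adicCompletionIntegers K) (w.adicCompletion L)) (H i j))
    (hHdet : IsUnit H.det)
    (hHinv : ∀ i j, IsLocalization.IsInteger
      (integralClosure (v.adicCompletionIntegers K) (w.adicCompletion L)) (H⁻¹ i j))
    (x : Fin 3 → w.adicCompletion L) (hx : x ≠ 0)
    (hx0 : letI := T5StarOfInvolution.starRingOfQuadratic h2 σ hσ;
      T5UnitaryGroupIsometry.sesqForm H x x = 0) :
    letI := T5StarOfInvolution.starRingOfQuadratic h2 σ hσ
    ∀ T S : T5HeckePermutationModule.heckeAlgebra k (T5UnitaryHeckeAdjoint.hyperspecialSubgroup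
      (integralClosure (v.adicCompletionIntegers K) (w.adicCompletion L)) H), T * S = S * T := by
  haveI := isLocalRing_integralClosure_adicCompletion v w
  exact T5InertHeckeCommutative.heckeAlgebra_mul_comm_of_isotropic_of_unramified
    (v.adicCompletionIntegers K) (v.adicCompletion K) (w.adicCompletion L) h2 σ hσ
    (map_maximalIdeal_integralClosure_eq_of_irreducible v w hϖ hinert) H k hH hHint hHdet hHinv
    x hx hx0

/-- The same with the ring of integers spelled `O_Lw = w.adicCompletionIntegers L`: entries and
inverse of `H` in `O_Lw`, and `K_H` the stabiliser of `O_Lw^3` in `U(H)`. -/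
theorem heckeAlgebra_mul_comm_adicCompletion'
    (h2 : Module.finrank (v.adicCompletion K) (w.adicCompletion L) = 2)
    {ϖ : v.adicCompletionIntegers K} (hϖ : Irreducible ϖ)
    (hinert : Irreducible (algebraMap (v.adicCompletionIntegers K) (w.adicCompletionIntegers L) ϖ))
    (σ : (w.adicCompletion L) ≃ₐ[v.adicCompletion K] (w.adicCompletion L)) (hσ : σ ≠ 1)
    (H : Matrix (Fin 3) (Fin 3) (w.adicCompletion L)) (k : Type*) [Field k]
    (hH : letI := T5StarOfInvolution.starRingOfQuadratic h2 σ hσ; H.IsHermitian)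
    (hHint : ∀ i j, IsLocalization.IsInteger (w.adicCompletionIntegers L) (H i j))
    (hHdet : IsUnit H.det)
    (hHinv : ∀ i j, IsLocalization.IsInteger (w.adicCompletionIntegers L) (H⁻¹ i j))
    (x : Fin 3 → w.adicCompletion L) (hx : x ≠ 0)
    (hx0 : letI := T5StarOfInvolution.starRingOfQuadratic h2 σ hσ;
      T5UnitaryGroupIsometry.sesqForm H x x = 0) :
    letI := T5StarOfInvolution.starRingOfQuadratic h2 σ hσ
    ∀ T S : T5HeckePermutationModule.heckeAlgebra k (T5UnitaryHeckeAdjoint.hyperspecialSubgroup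
      (w.adicCompletionIntegers L) H), T * S = S * T := by
  letI := T5StarOfInvolution.starRingOfQuadratic h2 σ hσ
  haveI : IsFractionRing (integralClosure (v.adicCompletionIntegers K) (w.adicCompletion L))
      (w.adicCompletion L) :=
    integralClosure.isFractionRing_of_finite_extension (v.adicCompletion K) (w.adicCompletion L)
  have h := heckeAlgebra_mul_comm_adicCompletion v w h2 hϖ hinert σ hσ H k hH
    (fun i j => (isInteger_integralClosure_iff_of_isIntegralClosure
      (A := w.adicCompletionIntegers L)).mpr (hHint i j)) hHdet
    (fun i j => (isInteger_integralClosure_iff_of_isIntegralClosure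
      (A := w.adicCompletionIntegers L)).mpr (hHinv i j)) x hx hx0
  rwa [hyperspecialSubgroup_integralClosure_eq (A := w.adicCompletionIntegers L)] at h

end Completion

end Summit.Ventures.HodgeRepro2.T5InertPlaceCompletion
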